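import Literature.AlgebraicGeometry.AbelianSchemes.AbelianSchemeQuotientDescentOfUnitRigid
import Literature.AlgebraicGeometry.AbelianSchemes.AbelianSchemeQuotientDualPairDivision
import HarnessLib

/-!
# The slice `(1 × c)^*(π × 1)^*𝒫` at an `n`-torsion point is trivial on a whole component once trivial somewhere (HECKE-LINK (K4-τ))

Layer `Literature/AlgebraicGeometry/AbelianSchemes`, namespace `Literature.AlgebraicGeometry.AbelianSchemes.AbelianSchemeOver.DualPair`.
THEOREMS ONLY (no definition, no named fact, no instance).

Setting ([MumfordAV1970] §15 Thm. 1, two-step descent of the cell `hodgecm-mathlib`, HECKE-LINK brick H2 / D6 (K)): `A/S` an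
abelian scheme over a reduced locally Noetherian base with dual pair `D = (Â, 𝒫)` and unit hypothesis `hD`; `K ⊆ A(S)` finite,
free, killed by `n`; `B := A/K` (★ `quotientBy`), `ψ : A → B`, `π : B → A` with `ψ ≫ π = [n]_A` (★ `mulNDesc`,
`quotientMk_comp_mulNDesc`); `N := (π × 1_Â)^*𝒫` on `B ×_S Â`.  For a test base `T′ → S` and a `T′`-valued point `c` of `Â`
with `cⁿ = 1`:

* §1 **the (τ) socket** `nonempty_pullback_whiskerRight_slice_iso_unit` — `ψ_T^*((1_B × c)^*N) ≅ 𝒪_{A_T}`: it is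
  `[n]_{A_T}^*((1_A × c)^*𝒫) ≅ (1_A × cⁿ)^*𝒫 = (1_A × 1)^*𝒫 ≅ 𝒪` (★ `nonempty_pullback_baseChangeToProd_whiskerRight_iso`, ★
  `baseChangeHom_left_eq_whiskerRight_left'`, ★ (SYM-n) `nonempty_pullback_mulN_pullbackP_iso_unit_of_pow_eq_one`);
* §2 `whiskerLeft_left_comp_baseChangeToProd` — restricting the slice along `U → T′`;
* §3 **`nonempty_pullback_baseChangeToProd_slice_iso_unit_of_nonempty`** — for `T′` connected, reduced, locally Noetherian with
  `n` invertible on it: if `(1_B × c)^*N` is trivial over SOME non-empty `U → T′`, it is trivial over `T′` (★ (K4)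
  `nonempty_iso_unit_of_pullback_quotientMk_iso_unit_of_nonempty`, p749978).  This is the step «trivial over `U` ⇒ trivial
  over the connected component» of the (K)/`hChar` assembly (B-plan1 (g14) 21:39:01Z (P2); B-p09 (g10) 23:11:21Z road (R-ℂ)),
  typed in the `N`-currency of ★ `PoincarePullbackTorsion` / ★ `PoincarePullbackStabilizerConstant`.

Count-neutral; HC_CM is proved only modulo the 7 printed citations until rung 0 closes — nothing here is about HC.

## References
* [MumfordAV1970] D. Mumford, *Abelian Varieties* (1970), §12 Thm. 1 (p. 112), §15 Thm. 1 (p. 143).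
* [MilneAV2008] J. S. Milne, *Abelian Varieties* (2008), I §8 (pp. 36–37), I §9.
-/

set_option autoImplicit false

noncomputable section

-- `(B.X ⊗ T′).left = (B.baseChange T′.hom).left`, `B.X = A.quotientOver u K` hold by `rfl` only.
set_option backward.isDefEq.respectTransparency false

universe u

open CategoryTheory CategoryTheory.Limits AlgebraicGeometry MonoidalCategory CartesianMonoidalCategory
open scoped MonObj

namespace Literature.AlgebraicGeometry.AbelianSchemes.AbelianSchemeOver

open Literature.AlgebraicGeometry.RelativeSpec Literature.AlgebraicGeometry.Modules Literature.AlgebraicGeometry.Motives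

variable {S : Scheme.{u}} (A : AbelianSchemeOver S)
  {Y : Scheme.{u}} (u : S ⟶ Y) (K : Subgroup A.Sections) [IsCommMonObj A.X] {n : ℕ}
  (hK : ∀ σ : K, (σ : A.Sections) ^ n = 1)
  [Finite K] [Y.IsSeparated] [IsSeparated (A.X.hom ≫ u)] [S.IsSeparated]
  (hcov : ∀ x : A.left, ∃ O : (A.translationActionOver u K).StableAffineOpens, x ∈ O.1)
  [LocallyOfFiniteType (A.X.hom ≫ u)] [IsLocallyNoetherian Y]
  (hG : ∃ _ : GrpObj (A.quotientOver u K), IsMonHom (A.quotientMk u K hcov))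
  (hsm : Smooth (A.quotientOver u K).hom) (hgc : GeometricallyConnected (A.quotientOver u K).hom)
  (D : A.DualPair) [IsAffine Y]
  (hfree : ∀ (Ω : Type u) [Field Ω] [IsAlgClosed Ω] (x : Spec (.of Ω) ⟶ A.left) (σ : K), σ ≠ 1 →
    x ≫ (A.translation (σ : A.Sections)).left ≠ x)

/-! ## §2 Restricting a slice along `U → T′` -/

omit [IsCommMonObj A.X] [Finite K] [Y.IsSeparated] [IsSeparated (A.X.hom ≫ u)] [S.IsSeparated]
  [LocallyOfFiniteType (A.X.hom ≫ u)] [IsLocallyNoetherian Y] [IsAffine Y] in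
/-- `(1_B × w) ≫ (1_B × c) = 1_B × (w ≫ c)` as maps `B_U → B ×_S Â` (the whiskered restriction `B ◁ (U → T′)` followed by a
slice is the slice of the restricted point). [cite: MilneAV2008, I §8 pp. 36–37] -/
theorem whiskerLeft_left_comp_baseChangeToProd (B B' : AbelianSchemeOver S) (T' : Over S) {U : Scheme.{u}} (w : U ⟶ T'.left)
    (c : T'.left ⟶ B'.X.left) (hc : c ≫ B'.X.hom = T'.hom) :
    (B.X ◁ (Over.homMk w rfl : Over.mk (w ≫ T'.hom) ⟶ T')).left ≫ B.baseChangeToProd B' T'.hom c hc =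
      B.baseChangeToProd B' (w ≫ T'.hom) (w ≫ c) (by rw [Category.assoc, hc]) := by
  apply pullback.hom_ext
  · rw [Category.assoc, baseChangeToProd_fst, baseChangeToProd_fst]
    exact Over.whiskerLeft_left_fst _
  · rw [Category.assoc, baseChangeToProd_snd, baseChangeToProd_snd, ← Category.assoc]
    exact congrArg (· ≫ c) (Over.whiskerLeft_left_snd _)

namespace DualPair

/-! ## §1 The (τ) socket: `ψ_T^*((1_B × c)^*N) ≅ 𝒪` for an `n`-torsion point `c` -/

omit [IsAffine Y] in
/-- **`ψ_T^*((1_B × c)^*((π × 1)^*𝒫)) ≅ 𝒪_{A_T}` for a `T′`-valued point `c` of `Â` with `cⁿ = 1`** (`B = A/K`, `ψ ≫ π = [n]_A`):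
`(1_B × c)^*((π × 1)^*𝒫) ≅ π_T^*((1_A × c)^*𝒫)`, `ψ_T ≫ π_T = [n]_{A_T}`, and `[n]_{A_T}^*((1_A × c)^*𝒫) ≅ (1_A × cⁿ)^*𝒫 ≅ 𝒪` (★
(SYM-n)).  This is the hypothesis `τ` of ★ `nonempty_iso_unit_of_pullback_quotientMk_iso_unit`.
[cite: MumfordAV1970, §15 Thm. 1 (p. 143)] [cite: MilneAV2008, I §8 pp. 36–37] -/
theorem nonempty_pullback_whiskerRight_slice_iso_unit [IsReduced S] [IsLocallyNoetherian S]
    (hD : Nonempty ((Scheme.Modules.pullback (unitHatSlice D)).obj D.P ≅ SheafOfModules.unit _))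
    (T' : Over S) (c : Over.mk T'.hom ⟶ D.hat.X) (hc : c ^ n = 1) :
    Nonempty ((Scheme.Modules.pullback (A.quotientMk u K hcov ▷ T').left).obj
      ((Scheme.Modules.pullback ((A.quotientBy u K hcov hG hsm hgc).baseChangeToProd D.hat T'.hom c.left (Over.w c))).obj
        ((Scheme.Modules.pullback (A.mulNDesc u K hK hcov ▷ D.hat.X).left).obj D.P)) ≅ SheafOfModules.unit _) := by
  -- `(1_B × c)^*N ≅ π_T^* 𝒫_c`
  obtain ⟨e₁⟩ := D.nonempty_pullback_baseChangeToProd_whiskerRight_iso (X := A.quotientBy u K hcov hG hsm hgc)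
    (A.mulNDesc u K hK hcov) T'.hom c.left (Over.w c)
  -- `[n]_{A_T}^* 𝒫_c ≅ 𝒪`
  obtain ⟨e₂⟩ := D.nonempty_pullback_mulN_pullbackP_iso_unit_of_pow_eq_one T'.hom hD c n hc
  -- `ψ_T ≫ π_T = [n]_{A_T}`
  have hψπ : (A.quotientMk u K hcov ▷ T').left ≫
      (@baseChangeHom S (A.quotientBy u K hcov hG hsm hgc) A T'.left (A.mulNDesc u K hK hcov) T'.hom).left =
      ((A.baseChange T'.hom).mulN n).left := by
    rw [← A.baseChangeHom_left_eq_whiskerRight_left' (A.quotientBy u K hcov hG hsm hgc) T' (A.quotientMk u K hcov),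
      A.baseChangeHom_left_comp_baseChangeHom_left (A.quotientBy u K hcov hG hsm hgc) T'.hom (A.quotientMk u K hcov)
        (A.mulNDesc u K hK hcov),
      A.quotientMk_comp_mulNDesc u K hK hcov, A.baseChangeHom_mulN T'.hom n]
  exact ⟨(Scheme.Modules.pullback _).mapIso e₁ ≪≫ (Scheme.Modules.pullbackComp _ _).app _ ≪≫
    (Scheme.Modules.pullbackCongr hψπ).app _ ≪≫ e₂⟩

/-! ## §3 Trivial somewhere ⇒ trivial on the whole (connected) test base -/

include hK hfree in
/-- **A slice `(1_B × c)^*N` (`N = (π × 1)^*𝒫`, `c` an `n`-torsion `T′`-valued point of `Â`) which is trivial over some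
NON-EMPTY `U → T′` is trivial over the whole of `T′`**, for `T′` connected, reduced, locally Noetherian with `n` invertible on it:
★ (K4) `nonempty_iso_unit_of_pullback_quotientMk_iso_unit_of_nonempty` with the socket `τ` of §1.  (The step «trivial over the
clopen piece `U` ⇒ trivial over the connected component» of the `hChar`/(K) assembly; the `N`-currency is that of ★
`PoincarePullbackStabilizerConstant` / `PoincarePullbackTorsion`.) [cite: MumfordAV1970, §15 Thm. 1 (p. 143)]
[cite: MumfordAV1970, §12 Thm. 1 (p. 112)] -/
theorem nonempty_pullback_baseChangeToProd_slice_iso_unit_of_nonempty [IsReduced S] [IsLocallyNoetherian S]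
    (hD : Nonempty ((Scheme.Modules.pullback (unitHatSlice D)).obj D.P ≅ SheafOfModules.unit _))
    (T' : Over S) [PreconnectedSpace T'.left] [IsReduced T'.left] [IsLocallyNoetherian T'.left]
    (hn : IsUnit (n : Γ(T'.left, ⊤))) (c : Over.mk T'.hom ⟶ D.hat.X) (hc : c ^ n = 1)
    {U : Scheme.{u}} (w : U ⟶ T'.left) [Nonempty U]
    (hU : Nonempty ((Scheme.Modules.pullback ((A.quotientBy u K hcov hG hsm hgc).baseChangeToProd D.hat (w ≫ T'.hom)
      (w ≫ c.left) (by rw [Category.assoc, Over.w c]; rfl))).obj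
        ((Scheme.Modules.pullback (A.mulNDesc u K hK hcov ▷ D.hat.X).left).obj D.P) ≅ SheafOfModules.unit _)) :
    Nonempty ((Scheme.Modules.pullback ((A.quotientBy u K hcov hG hsm hgc).baseChangeToProd D.hat T'.hom c.left
      (Over.w c))).obj ((Scheme.Modules.pullback (A.mulNDesc u K hK hcov ▷ D.hat.X).left).obj D.P) ≅
        SheafOfModules.unit _) := by
  obtain ⟨τ⟩ := nonempty_pullback_whiskerRight_slice_iso_unit A u K hK hcov hG hsm hgc D hD T' c hc
  obtain ⟨e⟩ := hU
  refine A.nonempty_iso_unit_of_pullback_quotientMk_iso_unit_of_nonempty T' u K hK hcov hfree hn _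
    (hasRank_pullback _ (hasRank_pullback _ D.hasRank_one)) τ w ⟨?_⟩
  -- restriction along `U → T′`: `(1_B × w)^*((1_B × c)^*N) ≅ (1_B × (w ≫ c))^*N ≅ 𝒪`
  exact (Scheme.Modules.pullbackComp _ _).app _ ≪≫
    (Scheme.Modules.pullbackCongr (whiskerLeft_left_comp_baseChangeToProd (A.quotientBy u K hcov hG hsm hgc) D.hat T' w
      c.left (Over.w c))).app _ ≪≫ e

end DualPair

end Literature.AlgebraicGeometry.AbelianSchemes.AbelianSchemeOver

end
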